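import Summits.CriticalPhenomena.SAWScalingLimit.Theses.SAWEdwardsStrongCoupling
import Summits.CriticalPhenomena.SAWScalingLimit.Theorems.SAWWeldingIdentificationLimitUpgrade
import Literature.Probability.RandomPlanarGeometry.SLEConvergenceCriterion
import HarnessLib.Audit

/-!
# Birth skeleton (`Lines/birth.lean`, BC3) for the crux `EdwardsWindowLimit` of route `SAWEdwardsStrongCoupling`
(item stmt-CriticalPhenomena-4652, rank 5: the CONSTRUCTION statement of the posited continuum object)

Crux, concluded BY NAME: `Summit.CriticalPhenomena.SAWScalingLimit.Theses.SAWEdwardsStrongCoupling.EdwardsWindowLimit`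
— for every `g > 0` there is a chordal family `Q_g` (`ChordalFamily.IsChordal`) such that for every Dobrushin
domain `(Ω; a, b)` and every endpoint approximation the critical Domb–Joyce (weakly self-avoiding, BDGS
`walkWeight`, fugacity `1/μ_λ`, both inlined as the shared `let w …; let WL …` of the route file) chordal law
in the EDWARDS WINDOW `λ = min 1 (g δ²)` converges weakly to `Q_g(D)` as `δ → 0⁺` (`TendstoLaw … id (Q D)`).

## The line = the classical existence-of-a-scaling-limit architecture (Billingsley/Prokhorov), typed in
the tree's own mesh vocabulary (`IsTightAlongMesh`, `IsSubseqLimitLaw`, `SLEConvergenceCriterion.lean`)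

Convergence in law along the countably generated filter `𝓝[>] 0` for EVERY approximation, to ONE law per
domain ⇐ (T) tightness of the window laws along the mesh + (E) the window laws are probability measures for
small meshes + (U) any two probability subsequential limits, along any two approximations of the same
Dobrushin domain, coincide + (C) subsequential limits are chordal laws of `(D; a, b)`. Four registered
stubs, each a genuine lemma of the line stated over tree declarations (the window law `WL` is the route's
inlined `let`, verbatim):

* `stub_windowTight` (T) — `IsTightAlongMesh` of the window laws; XL, the HARDEST (no mass escape at exact
  lattice criticality: the refuter's log-cancellation; annulus regularity of window walks). OPEN.
* `stub_windowEventuallyProb` (E) — eventually in `δ` the window law is a probability measure (total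
  Domb–Joyce weight over ALL walks of `Ω_δ` is positive and finite: superexponential self-intersection
  penalty in a finite graph); M, provable now.
* `stub_windowSubseqUnique` (U) — uniqueness of probability subsequential limits across approximations
  (Stoll's invariance principle in chordal critical form: the identification with Varadhan's tilted
  excursion, typed as uniqueness while `EdwardsExcursionLaw` is undefined); XL. OPEN.
* `stub_windowSubseqChordal` (C) — subsequential limits are carried by curves in `cl D` from `a` to `b`
  (portmanteau with closed sets); M, provable now.

`EdwardsWindowLimit_of : Registered.stub_windowTight → Registered.stub_windowEventuallyProb →
Registered.stub_windowSubseqUnique → Registered.stub_windowSubseqChordal → EdwardsWindowLimit` is PROVED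
below (no `sorry`): for a domain admitting an endpoint approximation `(a₀, b₀)`, Prokhorov along the mesh
for eventually-probability laws (`exists_isSubseqLimitLaw_of_eventually`: surrogate family + tree
`IsTightAlongMesh.exists_isSubseqLimitLaw`) gives a probability subsequential limit `μ_D`, chordal by (C);
for every approximation `(a, b)` of the same `D` the tree THEOREM
`Theorems.tendstoLaw_of_isTightAlongMesh_of_eventually` (Billingsley Thm 5.1 Corollary, stmt-4508 engine)
fed with (T), (E) and the identification "(U) against `μ_D`" upgrades to `TendstoLaw … id μ_D`; a domain
with no endpoint approximation gets the chordal test law `ChordalFamily.arcFamily D`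
(`isChordal_arcFamily`), where the convergence clause is vacuous; `choose` assembles `Q`.

Sorries: exactly 4 = the four `stub_*`; zero elsewhere. Disproof used: none exists for this crux at
registration (`ledger crux ls stmt-CriticalPhenomena-4652`: no workfiles). Negatives honoured:
stmt-CriticalPhenomena-0772 (all-`δ` `IsTightLaws`, refuted) is NOT the shape of (T) — (T) is eventual
(`IsTightAlongMesh`), and (E) is eventual along the approximation. No stub is the crux or the summit in
costume: (T), (E), (C) hold for families with several distinct subsequential limits, (U) and (C) are
vacuous without (T)+(E) (mass escape), and none mentions SLE; BC3 probes `stub → EdwardsWindowLimit`,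
`stub → SAWScalingLimit` by `first | exact? | simpa [S] | (unfold S; simpa) | aesop` FAIL (planner folder
`bc/*_probe.lean`).
-/

noncomputable section

open scoped BigOperators Topology Manifold Classical MeasureTheory ProbabilityTheory Matrix InnerProductSpace ComplexConjugate ContinuousMap
open Filter Set Function TopologicalSpace MeasureTheory
open Literature.Probability.RandomPlanarGeometry Literature.Probability.LatticeModels
open Summit.CriticalPhenomena.SAWScalingLimit.Theses.SAWEdwardsStrongCoupling (EdwardsWindowLimit)

namespace Summit.CriticalPhenomena.SAWScalingLimit.Cruxes.EdwardsWindowLimit.Birth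

/-! ## 1. The statements of the line (over tree declarations; `WL` = the route's inlined window law) -/

/-- **(T) WindowTight — tightness of the critical Domb–Joyce window laws along the mesh** (XL, the
HARDEST: the declared failure mode of the crux lives here). For every `g > 0`, Dobrushin domain and
endpoint approximation, the critical weakly self-avoiding chordal laws in the Edwards window
`λ = min 1 (g δ²)`, pushed to `CurveClass ℂ`, are tight as `δ → 0⁺` (`IsTightAlongMesh`, Billingsley's
eventual tightness; the all-`δ` form `IsTightLaws` is the refuted shape of stmt-CriticalPhenomena-0772 and
is NOT used). Content: no mass escape at EXACT lattice criticality `1/μ_λ` (the refuter's log-cancellation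
`log(4/μ_λ) = (1/π)λ log(1/λ) + κλ + o(λ)`), plus Aizenman–Burchard / Kemppainen–Smirnov regularity of the
window walks (at fixed `g` the law is comparable to the simple-random-walk excursion, Lawler 1991 §6.4).
[cite: Stoll1989] [cite: AizenmanBurchard1999, Thm 1.1–1.2] [cite: KemppainenSmirnov2017, Thm 1.5]
[cite: Lawler1991, §6.4] [cite: BDGS2012, §1.3 (1.12)] -/
def WindowTight : Prop :=
  let w : ℝ → (G : SimpleGraph (Literature.Probability.LatticeModels.Site 2)) → (u v : Literature.Probability.LatticeModels.Site 2) → G.Walk u v → ℝ := fun lam _G _u _v p => ∏ s ∈ Finset.range (p.length + 1), ∏ t ∈ Finset.Ioc s p.length, (1 - lam * if p.getVert s = p.getVert t then 1 else 0); let WL : ℝ → Set ℂ → ℝ → Literature.Probability.LatticeModels.Site 2 → Literature.Probability.LatticeModels.Site 2 → MeasureTheory.Measure (Literature.Probability.RandomPlanarGeometry.CurveClass ℂ) := fun lam Ω δ a b => (fun S : MeasureTheory.Measure (Literature.Probability.RandomPlanarGeometry.CurveClass ℂ) => (S Set.univ)⁻¹ • S) (MeasureTheory.Measure.sum fun p :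 (Literature.Probability.LatticeModels.discreteDomainGraph Ω δ).Walk a b => ENNReal.ofReal ((⨅ n : ℕ, (∑ x ∈ Literature.Probability.LatticeModels.box 2 (n + 1), ∑ q ∈ (Literature.Probability.LatticeModels.zdGraph 2).finsetWalkLength (n + 1) (0 : Literature.Probability.LatticeModels.Site 2) x, w lam (Literature.Probability.LatticeModels.zdGraph 2) 0 x q) ^ (1 / ((n : ℝ) + 1)))⁻¹ ^ p.length * w lam (Literature.Probability.LatticeModels.discreteDomainGraph Ω δ) a b p) • MeasureTheory.Measure.dirac (Literature.Probability.RandomPlanarGeometry.CurveClass.mk ⟨p.toCurve (Literature.Probability.LatticeModels.meshPoint δ)⟩)); ∀ g : ℝ, 0 < g → ∀ (D : Literature.Probability.RandomPlanarGeometry.DobrushinDomain) (a b : ℝ → Literature.Probability.LatticeModels.Site 2), Literature.Probability.RandomPlanarGeometry.SAW.IsEndpointApprox D a b → Literature.Probability.RandomPlanarGeometry.IsTightAlongMesh (fun (_ : ℝ) (x : Literature.Probability.RandomPlanarGeometry.CurveClass ℂ) => x) (fun δ => WL (min 1 (g * δ ^ 2)) D.carrier δ (a δ) (b δ))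

/-- **(E) WindowEventuallyProb — the window law is a genuine probability law for small meshes** (M,
provable now). Along an endpoint approximation and for `g > 0`, for all small `δ > 0` the inlined law
`WL (min 1 (g δ²)) Ω δ a_δ b_δ = (S univ)⁻¹ • S` is a probability measure: the total Domb–Joyce weight `S univ`
is `≠ 0` (`a_δ, b_δ` joined in `Ω_δ` ⇒ a self-avoiding path of weight `μ_λ^{-|p|} > 0`, `μ_λ ≥ 2 > 0`) and
`≠ ∞` (`Ω` bounded: a walk of length `n` in the finite vertex set `V = Ω_δ` has `J ≥ (n+1)²/(2|V|) − (n+1)/2`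
self-intersection pairs, so its weight `≤ (1-λ)^J μ_λ^{-n}` is summable over the `≤ 4ⁿ` walks, superexponentially
in `n`, for `0 < λ < 1`; at `λ = 1` only the finitely many SAWs count). Strengthens the route's support item
`WindowLawDichotomy` (stmt-CriticalPhenomena-4654: `WL = 0 ∨` probability) by excluding the junk value
eventually. [cite: BDGS2012, §1.2 (1.4)–(1.9), §1.3 (1.12)] [cite: MadrasSlade1993, §1.2] -/
def WindowEventuallyProb : Prop :=
  let w : ℝ → (G : SimpleGraph (Literature.Probability.LatticeModels.Site 2)) → (u v : Literature.Probability.LatticeModels.Site 2) → G.Walk u v → ℝ := fun lam _G _u _v p => ∏ s ∈ Finset.range (p.length + 1), ∏ t ∈ Finset.Ioc s p.length, (1 - lam * if p.getVert s = p.getVert t then 1 else 0); let WL : ℝ → Set ℂ → ℝ → Literature.Probability.LatticeModels.Site 2 → Literature.Probability.LatticeModels.Site 2 → MeasureTheory.Measure (Literature.Probability.RandomPlanarGeometry.CurveClass ℂ) := fun lam Ω δ a b => (fun S : MeasureTheory.Measure (Literature.Probability.RandomPlanarGeometry.CurveClass ℂ) => (S Set.univ)⁻¹ • S) (MeasureTheory.Measure.sum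 fun p : (Literature.Probability.LatticeModels.discreteDomainGraph Ω δ).Walk a b => ENNReal.ofReal ((⨅ n : ℕ, (∑ x ∈ Literature.Probability.LatticeModels.box 2 (n + 1), ∑ q ∈ (Literature.Probability.LatticeModels.zdGraph 2).finsetWalkLength (n + 1) (0 : Literature.Probability.LatticeModels.Site 2) x, w lam (Literature.Probability.LatticeModels.zdGraph 2) 0 x q) ^ (1 / ((n : ℝ) + 1)))⁻¹ ^ p.length * w lam (Literature.Probability.LatticeModels.discreteDomainGraph Ω δ) a b p) • MeasureTheory.Measure.dirac (Literature.Probability.RandomPlanarGeometry.CurveClass.mk ⟨p.toCurve (Literature.Probability.LatticeModels.meshPoint δ)⟩)); ∀ g : ℝ, 0 < g → ∀ (D : Literature.Probability.RandomPlanarGeometry.DobrushinDomain) (a b : ℝ → Literature.Probability.LatticeModels.Site 2), Literature.Probability.RandomPlanarGeometry.SAW.IsEndpointApprox D a b → Filter.Eventually (fun δ => MeasureTheory.IsProbabilityMeasure (WL (min 1 (g * δ ^ 2)) D.carrier δ (a δ) (b δ))) (nhdsWithin 0 (Set.Ioi 0))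

/-- **(U) WindowSubseqUnique — uniqueness of subsequential window limits = the identification step**
(XL). For `g > 0` and a Dobrushin domain `D`, any two probability measures arising as subsequential weak
limits (`IsSubseqLimitLaw`, mesh sequences `δ_n → 0⁺`) of the window laws along ANY two endpoint
approximations of `(D; a, b)` coincide. Intended proof: Stoll's invariance principle in chordal,
grand-canonical, critical form — every subsequential limit is Varadhan's renormalised Edwards tilt
`e^{θ_c(g)τ − gV_ren}` of the Brownian excursion law from `a` to `b` in `D` (LeGall's exponential moments of
renormalised self-intersection local time; independence of the limit from the lattice approximation of the
prime ends). This is where the continuum object `Q_g(D)` is pinned down; without the definition request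
`EdwardsExcursionLaw` it is typed as uniqueness rather than as an identity.
[cite: Stoll1989] [cite: Varadhan1969] [cite: LeGall1985, §0 (0-b)–(0-c)] [cite: LeGall1994]
[cite: denHollander2009, §5.3] -/
def WindowSubseqUnique : Prop :=
  let w : ℝ → (G : SimpleGraph (Literature.Probability.LatticeModels.Site 2)) → (u v : Literature.Probability.LatticeModels.Site 2) → G.Walk u v → ℝ := fun lam _G _u _v p => ∏ s ∈ Finset.range (p.length + 1), ∏ t ∈ Finset.Ioc s p.length, (1 - lam * if p.getVert s = p.getVert t then 1 else 0); let WL : ℝ → Set ℂ → ℝ → Literature.Probability.LatticeModels.Site 2 → Literature.Probability.LatticeModels.Site 2 → MeasureTheory.Measure (Literature.Probability.RandomPlanarGeometry.CurveClass ℂ) := fun lam Ω δ a b => (fun S : MeasureTheory.Measure (Literature.Probability.RandomPlanarGeometry.CurveClass ℂ) => (S Set.univ)⁻¹ • S) (MeasureTheory.Measure.sum fun p : (Literature.Probability.LatticeModels.discreteDomainGraph Ω δ).Walk a b => ENNReal.ofReal ((⨅ n : ℕ, (∑ x ∈ Literature.Probability.LatticeModels.box 2 (n + 1), ∑ q ∈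 (Literature.Probability.LatticeModels.zdGraph 2).finsetWalkLength (n + 1) (0 : Literature.Probability.LatticeModels.Site 2) x, w lam (Literature.Probability.LatticeModels.zdGraph 2) 0 x q) ^ (1 / ((n : ℝ) + 1)))⁻¹ ^ p.length * w lam (Literature.Probability.LatticeModels.discreteDomainGraph Ω δ) a b p) • MeasureTheory.Measure.dirac (Literature.Probability.RandomPlanarGeometry.CurveClass.mk ⟨p.toCurve (Literature.Probability.LatticeModels.meshPoint δ)⟩)); ∀ g : ℝ, 0 < g → ∀ (D : Literature.Probability.RandomPlanarGeometry.DobrushinDomain) (a b a' b' : ℝ → Literature.Probability.LatticeModels.Site 2), Literature.Probability.RandomPlanarGeometry.SAW.IsEndpointApprox D a b → Literature.Probability.RandomPlanarGeometry.SAW.IsEndpointApprox D a' b' → ∀ (ν ν' : MeasureTheory.Measure (Literature.Probability.RandomPlanarGeometry.CurveClass ℂ)), MeasureTheory.IsProbabilityMeasure ν → MeasureTheory.IsProbabilityMeasure ν' → Literature.Probability.RandomPlanarGeometry.IsSubseqLimitLaw (fun (_ : ℝ) (x : Literature.Probability.RandomPlanarGeometry.CurveClass ℂ) => x) (fun δ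 => WL (min 1 (g * δ ^ 2)) D.carrier δ (a δ) (b δ)) ν → Literature.Probability.RandomPlanarGeometry.IsSubseqLimitLaw (fun (_ : ℝ) (x : Literature.Probability.RandomPlanarGeometry.CurveClass ℂ) => x) (fun δ => WL (min 1 (g * δ ^ 2)) D.carrier δ (a' δ) (b' δ)) ν' → ν = ν'

/-- **(C) WindowSubseqChordal — subsequential window limits are chordal laws of `(D; a, b)`** (M,
portmanteau). Every probability subsequential weak limit of the window laws along an endpoint
approximation is carried by curves from `a = D.pt 0` to `b = D.pt 1` inside `closure D`: the lattice
polylines run in `Ω̄` from `δ·a_δ → a` to `δ·b_δ → b` (`IsEndpointApprox.tendsto_fst/snd`), the sets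
`{γ | γ.range ⊆ closure D}`, `{γ | dist (γ.source) a ≤ ε}` are closed in `CurveClass ℂ`, and closed sets
carry weak limits (tree: `TendstoLaw.ae_mem_of_isClosed`, `CLE6Limit.lean`, sequence version).
[cite: BillingsleyCPM1999, Thm 2.1 (portmanteau)] [cite: LawlerSchrammWerner2004SAW, §3.4.2] -/
def WindowSubseqChordal : Prop :=
  let w : ℝ → (G : SimpleGraph (Literature.Probability.LatticeModels.Site 2)) → (u v : Literature.Probability.LatticeModels.Site 2) → G.Walk u v → ℝ := fun lam _G _u _v p => ∏ s ∈ Finset.range (p.length + 1), ∏ t ∈ Finset.Ioc s p.length, (1 - lam * if p.getVert s = p.getVert t then 1 else 0); let WL : ℝ → Set ℂ → ℝ → Literature.Probability.LatticeModels.Site 2 → Literature.Probability.LatticeModels.Site 2 → MeasureTheory.Measure (Literature.Probability.RandomPlanarGeometry.CurveClass ℂ) := fun lam Ω δ a b => (fun S : MeasureTheory.Measure (Literature.Probability.RandomPlanarGeometry.CurveClass ℂ) => (S Set.univ)⁻¹ • S) (MeasureTheory.Measure.sum fun p : (Literature.Probability.LatticeModels.discreteDomainGraph Ω δ).Walk a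 b => ENNReal.ofReal ((⨅ n : ℕ, (∑ x ∈ Literature.Probability.LatticeModels.box 2 (n + 1), ∑ q ∈ (Literature.Probability.LatticeModels.zdGraph 2).finsetWalkLength (n + 1) (0 : Literature.Probability.LatticeModels.Site 2) x, w lam (Literature.Probability.LatticeModels.zdGraph 2) 0 x q) ^ (1 / ((n : ℝ) + 1)))⁻¹ ^ p.length * w lam (Literature.Probability.LatticeModels.discreteDomainGraph Ω δ) a b p) • MeasureTheory.Measure.dirac (Literature.Probability.RandomPlanarGeometry.CurveClass.mk ⟨p.toCurve (Literature.Probability.LatticeModels.meshPoint δ)⟩)); ∀ g : ℝ, 0 < g → ∀ (D : Literature.Probability.RandomPlanarGeometry.DobrushinDomain) (a b : ℝ → Literature.Probability.LatticeModels.Site 2), Literature.Probability.RandomPlanarGeometry.SAW.IsEndpointApprox D a b → ∀ ν : MeasureTheory.Measure (Literature.Probability.RandomPlanarGeometry.CurveClass ℂ), MeasureTheory.IsProbabilityMeasure ν → Literature.Probability.RandomPlanarGeometry.IsSubseqLimitLaw (fun (_ : ℝ) (x : Literature.Probability.RandomPlanarGeometry.CurveClass ℂ) => x) (fun δ => WL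 (min 1 (g * δ ^ 2)) D.carrier δ (a δ) (b δ)) ν → ∀ᵐ γ ∂ν, γ.source = D.pt 0 ∧ γ.target = D.pt 1 ∧ γ.range ⊆ closure D.carrier

/-! ## 2. Registered stubs -/

/-! The `stub_*` theorems are the registered obligations (sorried; statements LITERAL, the route's `let`
prefix included, so that the registered signatures are self-contained over tree declarations);
`Registered.stub_*` are the name-keyed `abbrev` aliases of their statements, used as the hypotheses of
`EdwardsWindowLimit_of`. -/
namespace Registered

abbrev stub_windowTight : Prop := WindowTight
abbrev stub_windowEventuallyProb : Prop := WindowEventuallyProb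
abbrev stub_windowSubseqUnique : Prop := WindowSubseqUnique
abbrev stub_windowSubseqChordal : Prop := WindowSubseqChordal

end Registered

/-- STUB 1 (XL, hardest): `WindowTight`, literal. -/
theorem stub_windowTight :
    let w : ℝ → (G : SimpleGraph (Literature.Probability.LatticeModels.Site 2)) → (u v : Literature.Probability.LatticeModels.Site 2) → G.Walk u v → ℝ := fun lam _G _u _v p => ∏ s ∈ Finset.range (p.length + 1), ∏ t ∈ Finset.Ioc s p.length, (1 - lam * if p.getVert s = p.getVert t then 1 else 0); let WL : ℝ → Set ℂ → ℝ → Literature.Probability.LatticeModels.Site 2 → Literature.Probability.LatticeModels.Site 2 → MeasureTheory.Measure (Literature.Probability.RandomPlanarGeometry.CurveClass ℂ) := fun lam Ω δ a b => (fun S : MeasureTheory.Measure (Literature.Probability.RandomPlanarGeometry.CurveClass ℂ) => (S Set.univ)⁻¹ • S) (MeasureTheory.Measure.sum fun p : (Literature.Probability.LatticeModels.discreteDomainGraph Ω δ).Walk a b => ENNReal.ofReal ((⨅ n : ℕ, (∑ x ∈ Literature.Probability.LatticeModels.box 2 (n + 1), ∑ q ∈ (Literature.Probability.LatticeModels.zdGraph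 2).finsetWalkLength (n + 1) (0 : Literature.Probability.LatticeModels.Site 2) x, w lam (Literature.Probability.LatticeModels.zdGraph 2) 0 x q) ^ (1 / ((n : ℝ) + 1)))⁻¹ ^ p.length * w lam (Literature.Probability.LatticeModels.discreteDomainGraph Ω δ) a b p) • MeasureTheory.Measure.dirac (Literature.Probability.RandomPlanarGeometry.CurveClass.mk ⟨p.toCurve (Literature.Probability.LatticeModels.meshPoint δ)⟩)); ∀ g : ℝ, 0 < g → ∀ (D : Literature.Probability.RandomPlanarGeometry.DobrushinDomain) (a b : ℝ → Literature.Probability.LatticeModels.Site 2), Literature.Probability.RandomPlanarGeometry.SAW.IsEndpointApprox D a b → Literature.Probability.RandomPlanarGeometry.IsTightAlongMesh (fun (_ : ℝ) (x : Literature.Probability.RandomPlanarGeometry.CurveClass ℂ) => x) (fun δ => WL (min 1 (g * δ ^ 2)) D.carrier δ (a δ) (b δ)) := by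
  sorry

/-- STUB 2 (M, provable now): `WindowEventuallyProb`, literal. -/
theorem stub_windowEventuallyProb :
    let w : ℝ → (G : SimpleGraph (Literature.Probability.LatticeModels.Site 2)) → (u v : Literature.Probability.LatticeModels.Site 2) → G.Walk u v → ℝ := fun lam _G _u _v p => ∏ s ∈ Finset.range (p.length + 1), ∏ t ∈ Finset.Ioc s p.length, (1 - lam * if p.getVert s = p.getVert t then 1 else 0); let WL : ℝ → Set ℂ → ℝ → Literature.Probability.LatticeModels.Site 2 → Literature.Probability.LatticeModels.Site 2 → MeasureTheory.Measure (Literature.Probability.RandomPlanarGeometry.CurveClass ℂ) := fun lam Ω δ a b => (fun S : MeasureTheory.Measure (Literature.Probability.RandomPlanarGeometry.CurveClass ℂ) => (S Set.univ)⁻¹ • S) (MeasureTheory.Measure.sum fun p : (Literature.Probability.LatticeModels.discreteDomainGraph Ω δ).Walk a b => ENNReal.ofReal ((⨅ n : ℕ, (∑ x ∈ Literature.Probability.LatticeModels.box 2 (n + 1), ∑ q ∈ (Literature.Probability.LatticeModels.zdGraph 2).finsetWalkLength (n + 1) (0 : Literature.Probability.LatticeModels.Site 2) x, w lam (Literature.Probability.LatticeModels.zdGraph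 2) 0 x q) ^ (1 / ((n : ℝ) + 1)))⁻¹ ^ p.length * w lam (Literature.Probability.LatticeModels.discreteDomainGraph Ω δ) a b p) • MeasureTheory.Measure.dirac (Literature.Probability.RandomPlanarGeometry.CurveClass.mk ⟨p.toCurve (Literature.Probability.LatticeModels.meshPoint δ)⟩)); ∀ g : ℝ, 0 < g → ∀ (D : Literature.Probability.RandomPlanarGeometry.DobrushinDomain) (a b : ℝ → Literature.Probability.LatticeModels.Site 2), Literature.Probability.RandomPlanarGeometry.SAW.IsEndpointApprox D a b → Filter.Eventually (fun δ => MeasureTheory.IsProbabilityMeasure (WL (min 1 (g * δ ^ 2)) D.carrier δ (a δ) (b δ))) (nhdsWithin 0 (Set.Ioi 0)) := by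
  sorry

/-- STUB 3 (XL): `WindowSubseqUnique`, literal. -/
theorem stub_windowSubseqUnique :
    let w : ℝ → (G : SimpleGraph (Literature.Probability.LatticeModels.Site 2)) → (u v : Literature.Probability.LatticeModels.Site 2) → G.Walk u v → ℝ := fun lam _G _u _v p => ∏ s ∈ Finset.range (p.length + 1), ∏ t ∈ Finset.Ioc s p.length, (1 - lam * if p.getVert s = p.getVert t then 1 else 0); let WL : ℝ → Set ℂ → ℝ → Literature.Probability.LatticeModels.Site 2 → Literature.Probability.LatticeModels.Site 2 → MeasureTheory.Measure (Literature.Probability.RandomPlanarGeometry.CurveClass ℂ) := fun lam Ω δ a b => (fun S : MeasureTheory.Measure (Literature.Probability.RandomPlanarGeometry.CurveClass ℂ) => (S Set.univ)⁻¹ • S) (MeasureTheory.Measure.sum fun p : (Literature.Probability.LatticeModels.discreteDomainGraph Ω δ).Walk a b => ENNReal.ofReal ((⨅ n : ℕ, (∑ x ∈ Literature.Probability.LatticeModels.box 2 (n + 1), ∑ q ∈ (Literature.Probability.LatticeModels.zdGraph 2).finsetWalkLength (n + 1) (0 : Literature.Probability.LatticeModels.Site 2) x, w lam (Literature.Probability.LatticeModels.zdGraph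 2) 0 x q) ^ (1 / ((n : ℝ) + 1)))⁻¹ ^ p.length * w lam (Literature.Probability.LatticeModels.discreteDomainGraph Ω δ) a b p) • MeasureTheory.Measure.dirac (Literature.Probability.RandomPlanarGeometry.CurveClass.mk ⟨p.toCurve (Literature.Probability.LatticeModels.meshPoint δ)⟩)); ∀ g : ℝ, 0 < g → ∀ (D : Literature.Probability.RandomPlanarGeometry.DobrushinDomain) (a b a' b' : ℝ → Literature.Probability.LatticeModels.Site 2), Literature.Probability.RandomPlanarGeometry.SAW.IsEndpointApprox D a b → Literature.Probability.RandomPlanarGeometry.SAW.IsEndpointApprox D a' b' → ∀ (ν ν' : MeasureTheory.Measure (Literature.Probability.RandomPlanarGeometry.CurveClass ℂ)), MeasureTheory.IsProbabilityMeasure ν → MeasureTheory.IsProbabilityMeasure ν' → Literature.Probability.RandomPlanarGeometry.IsSubseqLimitLaw (fun (_ : ℝ) (x : Literature.Probability.RandomPlanarGeometry.CurveClass ℂ) => x) (fun δ => WL (min 1 (g * δ ^ 2)) D.carrier δ (a δ) (b δ)) ν → Literature.Probability.RandomPlanarGeometry.IsSubseqLimitLaw (fun (_ : ℝ) (x : Literature.Probability.RandomPlanarGeometry.CurveClass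 ℂ) => x) (fun δ => WL (min 1 (g * δ ^ 2)) D.carrier δ (a' δ) (b' δ)) ν' → ν = ν' := by
  sorry

/-- STUB 4 (M, provable now): `WindowSubseqChordal`, literal. -/
theorem stub_windowSubseqChordal :
    let w : ℝ → (G : SimpleGraph (Literature.Probability.LatticeModels.Site 2)) → (u v : Literature.Probability.LatticeModels.Site 2) → G.Walk u v → ℝ := fun lam _G _u _v p => ∏ s ∈ Finset.range (p.length + 1), ∏ t ∈ Finset.Ioc s p.length, (1 - lam * if p.getVert s = p.getVert t then 1 else 0); let WL : ℝ → Set ℂ → ℝ → Literature.Probability.LatticeModels.Site 2 → Literature.Probability.LatticeModels.Site 2 → MeasureTheory.Measure (Literature.Probability.RandomPlanarGeometry.CurveClass ℂ) := fun lam Ω δ a b => (fun S : MeasureTheory.Measure (Literature.Probability.RandomPlanarGeometry.CurveClass ℂ) => (S Set.univ)⁻¹ • S) (MeasureTheory.Measure.sum fun p : (Literature.Probability.LatticeModels.discreteDomainGraph Ω δ).Walk a b => ENNReal.ofReal ((⨅ n : ℕ, (∑ x ∈ Literature.Probability.LatticeModels.box 2 (n + 1), ∑ q ∈ (Literature.Probability.LatticeModels.zdGraph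 2).finsetWalkLength (n + 1) (0 : Literature.Probability.LatticeModels.Site 2) x, w lam (Literature.Probability.LatticeModels.zdGraph 2) 0 x q) ^ (1 / ((n : ℝ) + 1)))⁻¹ ^ p.length * w lam (Literature.Probability.LatticeModels.discreteDomainGraph Ω δ) a b p) • MeasureTheory.Measure.dirac (Literature.Probability.RandomPlanarGeometry.CurveClass.mk ⟨p.toCurve (Literature.Probability.LatticeModels.meshPoint δ)⟩)); ∀ g : ℝ, 0 < g → ∀ (D : Literature.Probability.RandomPlanarGeometry.DobrushinDomain) (a b : ℝ → Literature.Probability.LatticeModels.Site 2), Literature.Probability.RandomPlanarGeometry.SAW.IsEndpointApprox D a b → ∀ ν : MeasureTheory.Measure (Literature.Probability.RandomPlanarGeometry.CurveClass ℂ), MeasureTheory.IsProbabilityMeasure ν → Literature.Probability.RandomPlanarGeometry.IsSubseqLimitLaw (fun (_ : ℝ) (x : Literature.Probability.RandomPlanarGeometry.CurveClass ℂ) => x) (fun δ => WL (min 1 (g * δ ^ 2)) D.carrier δ (a δ) (b δ)) ν → ∀ᵐ γ ∂ν, γ.source = D.pt 0 ∧ γ.target = D.pt 1 ∧ γ.range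 ⊆ closure D.carrier := by
  sorry

/-! The literal stubs are, by `rfl`, the named statements of §1. -/
example : WindowTight := stub_windowTight
example : WindowEventuallyProb := stub_windowEventuallyProb
example : WindowSubseqUnique := stub_windowSubseqUnique
example : WindowSubseqChordal := stub_windowSubseqChordal

/-! ## 3. Glue (sorry-free), over an ABSTRACT window law `WL` -/

section Glue

variable (WL : ℝ → Set ℂ → ℝ → Site 2 → Site 2 → Measure (CurveClass ℂ)) (g : ℝ)

/-- (T) at coupling `g`, for an abstract family of lattice laws `WL`. -/
def TightAlong : Prop :=
  ∀ (D : DobrushinDomain) (a b : ℝ → Site 2), SAW.IsEndpointApprox D a b →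
    IsTightAlongMesh (fun (_ : ℝ) (x : CurveClass ℂ) => x)
      (fun δ => WL (min 1 (g * δ ^ 2)) D.carrier δ (a δ) (b δ))

/-- (E) at coupling `g`. -/
def EventuallyProbAlong : Prop :=
  ∀ (D : DobrushinDomain) (a b : ℝ → Site 2), SAW.IsEndpointApprox D a b →
    Filter.Eventually (fun δ => IsProbabilityMeasure (WL (min 1 (g * δ ^ 2)) D.carrier δ (a δ) (b δ)))
      (nhdsWithin 0 (Set.Ioi 0))

/-- (U) at coupling `g`. -/
def UniqueAlong : Prop :=
  ∀ (D : DobrushinDomain) (a b a' b' : ℝ → Site 2), SAW.IsEndpointApprox D a b →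
    SAW.IsEndpointApprox D a' b' →
    ∀ (ν ν' : Measure (CurveClass ℂ)), IsProbabilityMeasure ν → IsProbabilityMeasure ν' →
      IsSubseqLimitLaw (fun (_ : ℝ) (x : CurveClass ℂ) => x)
        (fun δ => WL (min 1 (g * δ ^ 2)) D.carrier δ (a δ) (b δ)) ν →
      IsSubseqLimitLaw (fun (_ : ℝ) (x : CurveClass ℂ) => x)
        (fun δ => WL (min 1 (g * δ ^ 2)) D.carrier δ (a' δ) (b' δ)) ν' → ν = ν'

/-- (C) at coupling `g`. -/
def ChordalAlong : Prop :=
  ∀ (D : DobrushinDomain) (a b : ℝ → Site 2), SAW.IsEndpointApprox D a b →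
    ∀ ν : Measure (CurveClass ℂ), IsProbabilityMeasure ν →
      IsSubseqLimitLaw (fun (_ : ℝ) (x : CurveClass ℂ) => x)
        (fun δ => WL (min 1 (g * δ ^ 2)) D.carrier δ (a δ) (b δ)) ν →
      ∀ᵐ γ ∂ν, γ.source = D.pt 0 ∧ γ.target = D.pt 1 ∧ γ.range ⊆ closure D.carrier

/-- The conclusion of the crux at coupling `g`. -/
def LimitAlong : Prop :=
  ∃ Q : ChordalFamily, Q.IsChordal ∧
    ∀ (D : DobrushinDomain) (a b : ℝ → Site 2), SAW.IsEndpointApprox D a b →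
      TendstoLaw (fun (_ : ℝ) (x : CurveClass ℂ) => x)
        (fun δ => WL (min 1 (g * δ ^ 2)) D.carrier δ (a δ) (b δ)) id (Q D)

/-- **Prokhorov along the mesh for laws that are probability measures only eventually** (PROVED): a
family of laws on `CurveClass ℂ`, tight along `𝓝[>] 0` and probability for all small `δ > 0`, has a
probability subsequential limit law. Surrogate family (`= L δ` when that is a probability measure, a
Dirac mass otherwise) + the tree's `IsTightAlongMesh.exists_isSubseqLimitLaw`, transferred back along the
germ at `0⁺`. [cite: BillingsleyCPM1999, Thm. 5.1] -/
theorem exists_isSubseqLimitLaw_of_eventually (L : ℝ → Measure (CurveClass ℂ))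
    (hP : ∀ᶠ δ in 𝓝[>] (0 : ℝ), IsProbabilityMeasure (L δ))
    (hT : IsTightAlongMesh (Ωδ := fun _ : ℝ => CurveClass ℂ) (fun (_ : ℝ) (x : CurveClass ℂ) => x) L) :
    ∃ μ : Measure (CurveClass ℂ), IsProbabilityMeasure μ ∧
      IsSubseqLimitLaw (Ωδ := fun _ : ℝ => CurveClass ℂ) (fun (_ : ℝ) (x : CurveClass ℂ) => x) L μ := by
  classical
  -- (1) surrogate family of probability laws
  obtain ⟨ν, hν⟩ : ∃ ν : ℝ → Measure (CurveClass ℂ), ∀ δ, ν δ =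
      if IsProbabilityMeasure (L δ) then L δ else Measure.dirac (CurveClass.mk (Curve.const 0)) :=
    ⟨_, fun _ => rfl⟩
  haveI hνprob : ∀ δ, IsProbabilityMeasure (ν δ) := by
    intro δ
    by_cases h : IsProbabilityMeasure (L δ)
    · rw [hν δ, if_pos h]
      exact h
    · rw [hν δ, if_neg h]
      infer_instance
  -- (2) for all small `δ > 0` the surrogate IS the law
  have hev : ∀ᶠ δ in 𝓝[>] (0 : ℝ), ν δ = L δ := by
    filter_upwards [hP] with δ hδ
    rw [hν δ, if_pos hδ]
  -- (3) the surrogate family is tight along the mesh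
  have hTν : IsTightAlongMesh (Ωδ := fun _ : ℝ => CurveClass ℂ)
      (fun (_ : ℝ) (x : CurveClass ℂ) => x) ν := by
    intro ε hε
    obtain ⟨K, hK, hb⟩ := hT ε hε
    refine ⟨K, hK, ?_⟩
    filter_upwards [hb, hev] with δ hδ hδ'
    rw [hδ']
    exact hδ
  -- (4) Prokhorov for the surrogate family, transferred back
  obtain ⟨μ, hμ, s, hs, hlim⟩ := hTν.exists_isSubseqLimitLaw
    (Filter.Eventually.of_forall fun _ => aemeasurable_id')
  refine ⟨μ, hμ, s, hs, fun f => ?_⟩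
  have hevs : ∀ᶠ n in atTop, ν (s n) = L (s n) := hs.eventually hev
  refine (hlim f).congr' ?_
  filter_upwards [hevs] with n hn
  simp only [hn]

/-- **The glue (PROVED): (T) + (E) + (U) + (C) at coupling `g` give the window limit family `Q_g`.**
For a domain with an endpoint approximation `(a₀, b₀)`: a probability subsequential limit `μ_D`
(`exists_isSubseqLimitLaw_of_eventually`), chordal by (C); for every approximation `(a, b)` of `D` the
tree theorem `Theorems.tendstoLaw_of_isTightAlongMesh_of_eventually` with (T), (E) and "(U) against `μ_D`"
gives `TendstoLaw … id μ_D`. A domain with no approximation gets `ChordalFamily.arcFamily D`. -/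
theorem limitAlong_of (hT : TightAlong WL g) (hE : EventuallyProbAlong WL g) (hU : UniqueAlong WL g)
    (hC : ChordalAlong WL g) : LimitAlong WL g := by
  classical
  have hall : ∀ D : DobrushinDomain, ∃ ν : Measure (CurveClass ℂ), IsProbabilityMeasure ν ∧
      (∀ᵐ γ ∂ν, γ.source = D.pt 0 ∧ γ.target = D.pt 1 ∧ γ.range ⊆ closure D.carrier) ∧
      ∀ (a b : ℝ → Site 2), SAW.IsEndpointApprox D a b →
        TendstoLaw (fun (_ : ℝ) (x : CurveClass ℂ) => x)
          (fun δ => WL (min 1 (g * δ ^ 2)) D.carrier δ (a δ) (b δ)) id ν := by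
    intro D
    by_cases hD : ∃ a₀ : ℝ → Site 2, ∃ b₀ : ℝ → Site 2, SAW.IsEndpointApprox D a₀ b₀
    · obtain ⟨a₀, b₀, h₀⟩ := hD
      obtain ⟨μ, hμ, hμlim⟩ :=
        exists_isSubseqLimitLaw_of_eventually
          (fun δ => WL (min 1 (g * δ ^ 2)) D.carrier δ (a₀ δ) (b₀ δ)) (hE D a₀ b₀ h₀) (hT D a₀ b₀ h₀)
      refine ⟨μ, hμ, hC D a₀ b₀ h₀ μ hμ hμlim, fun a b hab => ?_⟩
      refine Summit.CriticalPhenomena.SAWScalingLimit.Theorems.tendstoLaw_of_isTightAlongMesh_of_eventually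
        (hE D a b hab) (Filter.Eventually.of_forall fun _ => aemeasurable_id') (hT D a b hab) ?_
      intro P' hP' s hs0 hs hlim
      have hs' : Tendsto s atTop (𝓝[>] (0 : ℝ)) :=
        tendsto_nhdsWithin_iff.2 ⟨hs, Filter.Eventually.of_forall fun n => Set.mem_Ioi.2 (hs0 n)⟩
      exact hU D a b a₀ b₀ hab h₀ P' μ hP' hμ ⟨s, hs', hlim⟩ hμlim
    · refine ⟨ChordalFamily.arcFamily D, (ChordalFamily.isChordal_arcFamily D).1,
        (ChordalFamily.isChordal_arcFamily D).2, fun a b hab => ?_⟩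
      exact absurd ⟨a, b, hab⟩ hD
  choose Q hQ using hall
  exact ⟨Q, fun D => ⟨(hQ D).1, (hQ D).2.1⟩, fun D a b hab => (hQ D).2.2 a b hab⟩

end Glue

/-! ## 4. The composition: the registered stubs imply the crux, BY NAME -/

/-- **`EdwardsWindowLimit_of` (kernel-checked, no `sorry` here): WindowTight → WindowEventuallyProb →
WindowSubseqUnique → WindowSubseqChordal → `SAWEdwardsStrongCoupling.EdwardsWindowLimit`.** The shared
`let w …; let WL …` of the crux is introduced as local definitions and the abstract glue `limitAlong_of`
is applied at every coupling `g > 0`. -/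
theorem EdwardsWindowLimit_of (hT : Registered.stub_windowTight)
    (hE : Registered.stub_windowEventuallyProb) (hU : Registered.stub_windowSubseqUnique)
    (hC : Registered.stub_windowSubseqChordal) : EdwardsWindowLimit := by
  show let w : ℝ → (G : SimpleGraph (Literature.Probability.LatticeModels.Site 2)) → (u v : Literature.Probability.LatticeModels.Site 2) → G.Walk u v → ℝ := fun lam _G _u _v p => ∏ s ∈ Finset.range (p.length + 1), ∏ t ∈ Finset.Ioc s p.length, (1 - lam * if p.getVert s = p.getVert t then 1 else 0); let WL : ℝ → Set ℂ → ℝ → Literature.Probability.LatticeModels.Site 2 → Literature.Probability.LatticeModels.Site 2 → MeasureTheory.Measure (Literature.Probability.RandomPlanarGeometry.CurveClass ℂ) := fun lam Ω δ a b => (fun S : MeasureTheory.Measure (Literature.Probability.RandomPlanarGeometry.CurveClass ℂ) => (S Set.univ)⁻¹ • S) (MeasureTheory.Measure.sum fun p : (Literature.Probability.LatticeModels.discreteDomainGraph Ω δ).Walk a b => ENNReal.ofReal ((⨅ n : ℕ, (∑ x ∈ Literature.Probability.LatticeModels.box 2 (n + 1), ∑ q ∈ (Literature.Probability.LatticeModels.zdGraph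 2).finsetWalkLength (n + 1) (0 : Literature.Probability.LatticeModels.Site 2) x, w lam (Literature.Probability.LatticeModels.zdGraph 2) 0 x q) ^ (1 / ((n : ℝ) + 1)))⁻¹ ^ p.length * w lam (Literature.Probability.LatticeModels.discreteDomainGraph Ω δ) a b p) • MeasureTheory.Measure.dirac (Literature.Probability.RandomPlanarGeometry.CurveClass.mk ⟨p.toCurve (Literature.Probability.LatticeModels.meshPoint δ)⟩)); ∀ g : ℝ, 0 < g → ∃ Q : Literature.Probability.RandomPlanarGeometry.ChordalFamily, Q.IsChordal ∧ ∀ (D : Literature.Probability.RandomPlanarGeometry.DobrushinDomain) (a b : ℝ → Literature.Probability.LatticeModels.Site 2), Literature.Probability.RandomPlanarGeometry.SAW.IsEndpointApprox D a b → Literature.Probability.RandomPlanarGeometry.TendstoLaw (fun (_ : ℝ) (x : Literature.Probability.RandomPlanarGeometry.CurveClass ℂ) => x) (fun δ => WL (min 1 (g * δ ^ 2)) D.carrier δ (a δ) (b δ)) id (Q D)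
  intro w WL g hg
  exact limitAlong_of WL g (hT g hg) (hE g hg) (hU g hg) (hC g hg)

/-- Hypothesis-free form: the crux modulo the four sorried stubs. -/
example : EdwardsWindowLimit :=
  EdwardsWindowLimit_of stub_windowTight stub_windowEventuallyProb stub_windowSubseqUnique
    stub_windowSubseqChordal

end Summit.CriticalPhenomena.SAWScalingLimit.Cruxes.EdwardsWindowLimit.Birth

end
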